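import Mathlib
import Summits.NavierStokesRegularity.NavierStokesRegularity.Theses.LevelSetModeration
import Summits.NavierStokesRegularity.NavierStokesRegularity.Theorems.LevelSetModerationHighSpeedPressureWorkUniformLevelSetClosure
import Summits.NavierStokesRegularity.NavierStokesRegularity.Theorems.HighSpeedPressureWork.Negative.ExponentCollapse

/-!
# Route LevelSetModeration — crux `HighSpeedPressureWork`, line `linear_closure`: the transfer with L2 discharged

Two compositions of the landed class-uniform De Giorgi closure `stub_uniformLevelSetClosure` (L2 of
line `linear_closure`, item stmt-NavierStokesRegularity-18149):

* `levelSetModeration_aprioriSpeedBound_of_linearLevelSetLaw` — on a fibre `(ν, T)`, the LINEAR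
  level-set law with `m < 10/3` and a data modulus `Λ(E₀,B₀)` on all windows `M ≥ 2B₀` gives a
  class-uniform a priori speed bound `APrioriSpeedBound ν T G` (the disprover's §1 hypothesis;
  Tao-type uniform quantitative regularity of the data class): `G(E₀,B₀)` is the closure constant
  at `M₀ := 2·max(B₀,0)+2`.
* `levelSetModeration_highSpeedPressureWork_of_linearLaw_of_bookkeeping` — the crux BY NAME from the
  two remaining registered stubs of the line, `stub_linearLevelSetLaw` (L1, open) and
  `stub_boundedPairingBookkeeping` (L3), verbatim as hypotheses: the strategist's glue
  `Lines/LinearSplit.lean` with its middle hypothesis (L2) replaced by the theorem; exponent `0`.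
-/

noncomputable section

-- single-conjunct summit: `Summit.<Summit>.<Problem>` repeats the name by the D-0017 layout
set_option linter.dupNamespace false

namespace Summit.NavierStokesRegularity.NavierStokesRegularity.Theorems

open MeasureTheory Set Filter Topology
open scoped ENNReal
open Literature.Analysis.FluidPDE
open Summit.NavierStokesRegularity.NavierStokesRegularity.Theses.LevelSetModeration

/-- **The linear level-set law gives a class-uniform a priori speed bound.** On a fibre `(ν, T)`,
if every classical Leray–Hopf solution from a rapidly decaying datum with `∫|u₀|² ≤ E₀`, `|u₀| ≤ B₀`
obeys `ν² D_c(T) ≤ Λ(E₀,B₀) M^m V_c(T)` and `∫(|u(t)|−c)₊² ≤ 4Λ(E₀,B₀) M^m V_c(T)/ν` on all windows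
`M ≥ 2B₀`, `c ∈ [M/2, M]` (`m < 10/3`), then `‖u‖ ≤ G(E₀,B₀)` on `[0,T) × ℝ³` class-uniformly
(`stub_uniformLevelSetClosure` at `M₀ := 2·max(B₀,0)+2`). -/
theorem levelSetModeration_aprioriSpeedBound_of_linearLevelSetLaw :
    ∀ (ν T m : ℝ) (Λ : ℝ → ℝ → ℝ), 0 < ν → 0 < T → m < 10 / 3 → (∀ (u : ℝ → EuclideanSpace ℝ (Fin
      3) → EuclideanSpace ℝ (Fin 3)) (p : ℝ → EuclideanSpace ℝ (Fin 3) → ℝ),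
      Literature.Analysis.FluidPDE.IsClassicalNSSolutionOn (Set.Ico 0 T) ν 0 u p →
      Literature.Analysis.FluidPDE.IsLerayHopfOn T ν 0 (u 0) u →
      Literature.Analysis.FluidPDE.HasRapidSpatialDecay (u 0) → ∀ (E₀ B₀ : ℝ), (∫ x, ‖u 0 x‖ ^ 2) ≤
      E₀ → (∀ x, ‖u 0 x‖ ≤ B₀) → ∀ (M c : ℝ), 2 * B₀ ≤ M → M / 2 ≤ c → c ≤ M → 0 < c → ν ^ 2 * (∫⁻
      τ in Set.Ioo 0 T, ∫⁻ x, Set.indicator {x | c < ‖u τ x‖} (fun x => ENNReal.ofReal (‖fderiv ℝ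
      (fun y => ‖u τ y‖) x‖ ^ 2)) x).toReal ≤ Λ E₀ B₀ * M ^ m * (∫⁻ τ in Set.Ioo 0 T,
      MeasureTheory.volume {x | c < ‖u τ x‖}).toReal ∧ ∀ t ∈ Set.Ico 0 T, (∫ x, (max (‖u t x‖ - c)
      0) ^ 2) ≤ 4 * (Λ E₀ B₀ * M ^ m * (∫⁻ τ in Set.Ioo 0 T, MeasureTheory.volume {x | c < ‖u τ
      x‖}).toReal) / ν) → ∃ G : ℝ → ℝ → ℝ,
      Summit.NavierStokesRegularity.NavierStokesRegularity.Theorems.HighSpeedPressureWork.Negative.APrioriSpeedBound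
      ν T G := by
  intro ν T m Λ hν hT hm hlaw
  have hGex : ∀ E₀ B₀ : ℝ, ∃ G : ℝ,
      ∀ (u : ℝ → EuclideanSpace ℝ (Fin 3) → EuclideanSpace ℝ (Fin 3))
        (p : ℝ → EuclideanSpace ℝ (Fin 3) → ℝ),
        IsClassicalNSSolutionOn (Set.Ico 0 T) ν 0 u p → IsLerayHopfOn T ν 0 (u 0) u →
        HasRapidSpatialDecay (u 0) →
        (∫ x, ‖u 0 x‖ ^ 2) ≤ E₀ → (∀ x, ‖u 0 x‖ ≤ B₀) →
        ∀ t ∈ Set.Ico 0 T, ∀ x, ‖u t x‖ ≤ G := by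
    intro E₀ B₀
    have hB : B₀ ≤ max B₀ 0 := le_max_left _ _
    have hM₀ : 0 < 2 * max B₀ 0 + 2 := by positivity
    obtain ⟨G, hG⟩ := stub_uniformLevelSetClosure ν T m (Λ E₀ B₀) E₀ (2 * max B₀ 0 + 2) hν hT hm hM₀
    refine ⟨G, fun u p hcl hLH hdec hE hB₀ => hG u p hcl hLH hdec hE ?_ ?_⟩
    · intro x
      have hx := hB₀ x
      linarith
    · intro M c hM hMc hcM hc
      exact hlaw u p hcl hLH hdec E₀ B₀ hE hB₀ M c (by linarith) hMc hcM hc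
  choose G hG using hGex
  exact ⟨G, fun u p hcl hLH hdec E₀ B₀ hE hB₀ => hG E₀ B₀ u p hcl hLH hdec hE hB₀⟩

/-- **`HighSpeedPressureWork` from the linear law and the bounded bookkeeping** (line
`linear_closure` with its middle stub discharged): `(m, Λ)` from the linear level-set law (L1),
the class-uniform speed bound from `levelSetModeration_aprioriSpeedBound_of_linearLevelSetLaw`,
the modulus `F` from the bookkeeping (L3); exponent `0 < 10/3`, `M^0 = 1`. -/
theorem levelSetModeration_highSpeedPressureWork_of_linearLaw_of_bookkeeping :
    (∀ (ν T : ℝ), 0 < ν → 0 < T → ∃ m : ℝ, m < 10 / 3 ∧ ∃ Λ : ℝ → ℝ → ℝ, ∀ (u : ℝ → EuclideanSpace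
      ℝ (Fin 3) → EuclideanSpace ℝ (Fin 3)) (p : ℝ → EuclideanSpace ℝ (Fin 3) → ℝ),
      Literature.Analysis.FluidPDE.IsClassicalNSSolutionOn (Set.Ico 0 T) ν 0 u p →
      Literature.Analysis.FluidPDE.IsLerayHopfOn T ν 0 (u 0) u →
      Literature.Analysis.FluidPDE.HasRapidSpatialDecay (u 0) → ∀ (E₀ B₀ : ℝ), (∫ x, ‖u 0 x‖ ^ 2) ≤
      E₀ → (∀ x, ‖u 0 x‖ ≤ B₀) → ∀ (M c : ℝ), 2 * B₀ ≤ M → M / 2 ≤ c → c ≤ M → 0 < c → ν ^ 2 * (∫⁻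
      τ in Set.Ioo 0 T, ∫⁻ x, Set.indicator {x | c < ‖u τ x‖} (fun x => ENNReal.ofReal (‖fderiv ℝ
      (fun y => ‖u τ y‖) x‖ ^ 2)) x).toReal ≤ Λ E₀ B₀ * M ^ m * (∫⁻ τ in Set.Ioo 0 T,
      MeasureTheory.volume {x | c < ‖u τ x‖}).toReal ∧ ∀ t ∈ Set.Ico 0 T, (∫ x, (max (‖u t x‖ - c)
      0) ^ 2) ≤ 4 * (Λ E₀ B₀ * M ^ m * (∫⁻ τ in Set.Ioo 0 T, MeasureTheory.volume {x | c < ‖u τ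
      x‖}).toReal) / ν) → (∀ (ν T : ℝ), 0 < ν → 0 < T → ∀ G : ℝ → ℝ → ℝ, (∀ (u : ℝ → EuclideanSpace
      ℝ (Fin 3) → EuclideanSpace ℝ (Fin 3)) (p : ℝ → EuclideanSpace ℝ (Fin 3) → ℝ),
      Literature.Analysis.FluidPDE.IsClassicalNSSolutionOn (Set.Ico 0 T) ν 0 u p →
      Literature.Analysis.FluidPDE.IsLerayHopfOn T ν 0 (u 0) u →
      Literature.Analysis.FluidPDE.HasRapidSpatialDecay (u 0) → ∀ (E₀ B₀ : ℝ), (∫ x, ‖u 0 x‖ ^ 2) ≤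
      E₀ → (∀ x, ‖u 0 x‖ ≤ B₀) → ∀ t ∈ Set.Ico 0 T, ∀ x, ‖u t x‖ ≤ G E₀ B₀) → ∃ F : ℝ → ℝ → ℝ, ∀ (u
      : ℝ → EuclideanSpace ℝ (Fin 3) → EuclideanSpace ℝ (Fin 3)) (p : ℝ → EuclideanSpace ℝ (Fin 3)
      → ℝ), Literature.Analysis.FluidPDE.IsClassicalNSSolutionOn (Set.Ico 0 T) ν 0 u p →
      Literature.Analysis.FluidPDE.IsLerayHopfOn T ν 0 (u 0) u →
      Literature.Analysis.FluidPDE.HasRapidSpatialDecay (u 0) → ∀ (E₀ B₀ : ℝ), (∫ x, ‖u 0 x‖ ^ 2) ≤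
      E₀ → (∀ x, ‖u 0 x‖ ≤ B₀) → ∀ (M c t : ℝ), 2 * B₀ ≤ M → M / 2 ≤ c → c ≤ M → 0 < c → t ∈
      Set.Ico 0 T → -(∫ τ in Set.Ioo 0 t, ∫ x, max (1 - c / ‖u τ x‖) 0 * (fderiv ℝ
      (Literature.Analysis.FluidPDE.normalisedPressure (u τ)) x (u τ x))) ≤ Real.sqrt (F E₀ B₀ *
      (∫⁻ τ in Set.Ioo 0 T, MeasureTheory.volume {x | c < ‖u τ x‖}).toReal) * Real.sqrt ((∫⁻ τ in
      Set.Ioo 0 T, ∫⁻ x, Set.indicator {x | c < ‖u τ x‖} (fun x => ENNReal.ofReal (‖fderiv ℝ (fun y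
      => ‖u τ y‖) x‖ ^ 2)) x).toReal)) →
      Summit.NavierStokesRegularity.NavierStokesRegularity.Theses.LevelSetModeration.HighSpeedPressureWork := by
  intro hLaw hBook ν T hν hT
  obtain ⟨m, hm, Λ, hΛ⟩ := hLaw ν T hν hT
  obtain ⟨G, hG⟩ := levelSetModeration_aprioriSpeedBound_of_linearLevelSetLaw ν T m Λ hν hT hm hΛ
  obtain ⟨F, hF⟩ := hBook ν T hν hT G hG
  refine ⟨0, by norm_num, F, ?_⟩
  intro u p hcl hLH hdec E₀ B₀ hE hB₀ M c t hM hMc hcM hc ht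
  rw [Real.rpow_zero, mul_one]
  exact hF u p hcl hLH hdec E₀ B₀ hE hB₀ M c t hM hMc hcM hc ht

end Summit.NavierStokesRegularity.NavierStokesRegularity.Theorems

end
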